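import Summits.QuantumAdvantage.QuantumAdvantage.Theorems.CharDialPartyDialI1

/-!
# PartyDial (decomp-qadv lens-5 g35), part I2 — §8c: hybrid_law_core (k disjoint pairs, every cut but g₀ blind/non-splitting, g₀ of F_p-degree ≤ D, GIVEN LowDegIndep3At ⟹ ≤ (1 − 4^{-(k+1)})·2ⁿ)

See part A (`CharDialPartyDialA`) for the node header; memo `NODE-g35.md` (g35 folder of decomp-qadv-lens-5).
-/

set_option autoImplicit false
set_option linter.dupNamespace false

namespace Summit.QuantumAdvantage.QuantumAdvantage.Theorems.PartyDial

open Finset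
open Summit.QuantumAdvantage.AdviceFreeQNC0

/-! ### §8c  The hybrid law -/

section HybridLaw

open Literature.Computability.MetaComplexity

variable {n k : ℕ} {lo hi : Fin k → ℕ}

/-- ★★ **HYBRID LAW (core)**: `k` disjoint pairs, every cut EXCEPT `g₀` blind to one of them and not splitting it,
the cut `g₀` of `𝔽_p`-degree `≤ D`, and the fact `LowDegIndep3At p (3^k·D) (1/(12·2^{3^k})) m₀` with
`m₀ + 2k ≤ n` ⟹ `#WIN ≤ (1 − 4^{−(k+1)})·2ⁿ`, every charge. -/
theorem hybrid_law_core (hP : PairsOK lo hi) (hlt : ∀ j, lo j < n ∧ hi j < n) (c : ℕ)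
    (y : Fin (n + 1) → (Fin n → Bool) → Bool) (g₀ : Fin (n + 1))
    (hbl : ∀ g : Fin (n + 1), g ≠ g₀ → ∃ j : Fin k, (lo j < g.val ↔ hi j < g.val) ∧
      ∀ u v : Fin n → Bool, (∀ i : Fin n, i.val ≠ lo j → i.val ≠ hi j → u i = v i) → y g u = y g v)
    {p : ℕ} [Fact p.Prime] {D m₀ : ℕ} (hdeg : HasDegF p (y g₀) D)
    (hF : LowDegIndep3At p (3 ^ k * D) (1 / (12 * 2 ^ 3 ^ k)) m₀) (hm : m₀ + 2 * k ≤ n) :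
    ((univ.filter fun u : Fin n → Bool => ringWinU c y u = true).card : ℝ) ≤
      (1 - (1 / 4 : ℝ) ^ (k + 1)) * (2 : ℝ) ^ n := by
  classical
  -- the dense cut's answer pattern over `t`, the free residue, the exceptional count
  set Φ : (Fin n → Bool) → (Fin k → Fin 3) → Bool := fun t z => y g₀ (fill lo hi t z) with hΦ
  set A : (Fin n → Bool) → ℕ := fun t => c + g₀.val + freeW lo hi t g₀.val with hA
  set s : (Fin k → Fin 3) → ℕ := fun z => pairW lo hi z g₀.val (n := n) with hs
  have hN : ∀ t, (univ.filter fun z : Fin k → Fin 3 => y g₀ (fill lo hi t z) = true ∧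
      (c + g₀.val + walkExp (fill lo hi t z) g₀.val) % 3 ≠ 0) =
      univ.filter fun z : Fin k → Fin 3 => Φ t z = true ∧ (A t + s z) % 3 ≠ 0 := by
    intro t
    refine Finset.filter_congr fun z _ => ?_
    rw [walkExp_fill t z g₀.val, hA, hs]
    simp only [hΦ]
    rw [show c + g₀.val + (freeW lo hi t g₀.val + pairW lo hi z g₀.val) =
      c + g₀.val + freeW lo hi t g₀.val + pairW lo hi z g₀.val by ring]
  -- one even residue per pattern
  choose r hr using fun φ : (Fin k → Fin 3) → Bool => exists_even_residue φ s
  -- the good free assignments: pattern `φ` and free residue `r φ`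
  set Gφ : ((Fin k → Fin 3) → Bool) → Finset (Fin n → Bool) := fun φ =>
    univ.filter fun t => decide (∀ z, Φ t z = φ z) = true ∧ (A t) % 3 = (r φ).val % 3 with hGφ
  set G : Finset (Fin n → Bool) := univ.filter fun t => ∃ z : Fin k → Fin 3, ringWinU c y (fill lo hi t z) = false
    with hG
  -- (1) every good assignment has a grid loser
  have hGφ_sub : ∀ φ, Gφ φ ⊆ G := by
    intro φ t ht
    rw [hGφ, mem_filter] at ht
    obtain ⟨_, hpat, hres⟩ := ht
    have hpat' : ∀ z, Φ t z = φ z := of_decide_eq_true hpat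
    rw [hG, mem_filter]
    refine ⟨mem_univ _, grid_loser_except hP hlt t c y g₀ hbl ?_⟩
    rw [hN t]
    have he := hr φ
    rw [Finset.filter_congr (q := fun z : Fin k → Fin 3 => φ z = true ∧ ((r φ).val + s z) % 3 ≠ 0)
      fun z _ => by rw [hpat' z, Nat.add_mod, hres, ← Nat.add_mod]]
    exact he
  -- (2) the good assignments are many: `2ⁿ/4 ≤ #G`
  have hdisj : ∀ φ ∈ (univ : Finset ((Fin k → Fin 3) → Bool)), ∀ φ' ∈ (univ : Finset ((Fin k → Fin 3) → Bool)),
      φ ≠ φ' → Disjoint (Gφ φ) (Gφ φ') := by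
    intro φ _ φ' _ hne
    rw [Finset.disjoint_left]
    intro t ht ht'
    rw [hGφ, mem_filter] at ht ht'
    have h1 : ∀ z, Φ t z = φ z := of_decide_eq_true ht.2.1
    have h2 : ∀ z, Φ t z = φ' z := of_decide_eq_true ht'.2.1
    exact hne (funext fun z => (h1 z).symm.trans (h2 z))
  have hw : m₀ ≤ (univ.filter fun i : Fin n =>
      (if i ∈ freeOf lo hi (n := n) then (if i.val < g₀.val then 2 else 1) else 0) % 3 ≠ 0).card := by
    rw [card_weights_nonzero]
    have := card_freeOf_ge (lo := lo) (hi := hi) (n := n)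
    omega
  have hFφ : ∀ φ, ((univ.filter fun t : Fin n → Bool => decide (∀ z, Φ t z = φ z) = true).card : ℝ) / 3 -
      1 / (12 * 2 ^ 3 ^ k) * (2 : ℝ) ^ n ≤ ((Gφ φ).card : ℝ) := by
    intro φ
    have hdegφ : HasDegF p (fun t => decide (∀ z, Φ t z = φ z)) (3 ^ k * D) := by
      have h := hasDegF_pattern (fun (z : Fin k → Fin 3) (t : Fin n → Bool) => Φ t z)
        (fun z => hasDegF_fill (lo := lo) (hi := hi) hdeg z) φ
      rwa [Fintype.card_fun, Fintype.card_fin, Fintype.card_fin] at h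
    have h := hF n _ hdegφ _ hw (c + g₀.val) (r φ).val
    have hset : (univ.filter fun t : Fin n → Bool => decide (∀ z, Φ t z = φ z) = true ∧
        (c + g₀.val + linW (fun i : Fin n => if i ∈ freeOf lo hi (n := n) then
          (if i.val < g₀.val then 2 else 1) else 0) t) % 3 = (r φ).val % 3) = Gφ φ := by
      rw [hGφ]
      refine Finset.filter_congr fun t _ => ?_
      rw [hA]
      simp only
      rw [freeW_eq_linW]
    rw [hset] at h
    exact h
  have hpart : ∑ φ : (Fin k → Fin 3) → Bool,
      ((univ.filter fun t : Fin n → Bool => decide (∀ z, Φ t z = φ z) = true).card : ℝ) = (2 : ℝ) ^ n := by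
    have h := Finset.card_eq_sum_card_fiberwise (s := (univ : Finset (Fin n → Bool)))
      (t := (univ : Finset ((Fin k → Fin 3) → Bool))) (f := fun t => Φ t) fun _ _ => mem_univ _
    rw [Finset.card_univ, Fintype.card_fun, Fintype.card_bool, Fintype.card_fin] at h
    have h' : ((2 : ℕ) ^ n : ℝ) = ∑ φ : (Fin k → Fin 3) → Bool,
        ((univ.filter fun t : Fin n → Bool => Φ t = φ).card : ℝ) := by exact_mod_cast h
    push_cast at h'
    rw [h']
    refine Finset.sum_congr rfl fun φ _ => ?_
    congr 2
    ext t
    simp only [mem_filter, mem_univ, true_and, decide_eq_true_eq]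
    exact funext_iff.symm
  have hnumφ : (Fintype.card ((Fin k → Fin 3) → Bool) : ℝ) = (2 : ℝ) ^ 3 ^ k := by
    rw [Fintype.card_fun, Fintype.card_bool, Fintype.card_fun, Fintype.card_fin, Fintype.card_fin]
    push_cast
    ring
  have hGcard : (2 : ℝ) ^ n / 4 ≤ (G.card : ℝ) := by
    have hU : ((univ : Finset ((Fin k → Fin 3) → Bool)).biUnion Gφ).card ≤ G.card :=
      card_le_card (Finset.biUnion_subset.2 fun φ _ => hGφ_sub φ)
    rw [Finset.card_biUnion hdisj] at hU
    have hU' : (∑ φ : (Fin k → Fin 3) → Bool, ((Gφ φ).card : ℝ)) ≤ (G.card : ℝ) := by exact_mod_cast hU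
    have hsum : ∑ φ : (Fin k → Fin 3) → Bool,
        (((univ.filter fun t : Fin n → Bool => decide (∀ z, Φ t z = φ z) = true).card : ℝ) / 3 -
          1 / (12 * 2 ^ 3 ^ k) * (2 : ℝ) ^ n) ≤ ∑ φ : (Fin k → Fin 3) → Bool, ((Gφ φ).card : ℝ) :=
      Finset.sum_le_sum fun φ _ => hFφ φ
    rw [Finset.sum_sub_distrib, ← Finset.sum_div, hpart, Finset.sum_const, Finset.card_univ, nsmul_eq_mul,
      hnumφ] at hsum
    have hpos : (0 : ℝ) < (2 : ℝ) ^ 3 ^ k := by positivity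
    have he : (2 : ℝ) ^ 3 ^ k * (1 / (12 * 2 ^ 3 ^ k) * (2 : ℝ) ^ n) = (2 : ℝ) ^ n / 12 := by
      field_simp
    rw [he] at hsum
    linarith
  -- (3) each loser arises from at most `4^k` good assignments
  choose zl hzl using fun t : ↥G => (mem_filter.1 t.2).2
  set f : (Fin n → Bool) → (Fin n → Bool) := fun t =>
    if ht : t ∈ G then fill lo hi t (zl ⟨t, ht⟩) else t with hf
  have hfib : ∀ u ∈ G.image f, (G.filter fun t => f t = u).card ≤ 4 ^ k := by
    intro u _
    calc (G.filter fun t => f t = u).card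
        ≤ (univ.filter fun t : Fin n → Bool => ∀ i ∈ freeOf lo hi (n := n), t i = u i).card := by
          refine card_le_card fun t ht => ?_
          rw [mem_filter] at ht
          obtain ⟨htG, htu⟩ := ht
          refine mem_filter.2 ⟨mem_univ _, fun i hi0 => ?_⟩
          rw [← htu, hf]
          simp only [htG, dif_pos]
          rw [fill_free t _ i (mem_filter.1 hi0).2]
      _ ≤ 2 ^ ((freeOf lo hi (n := n))ᶜ.card) := card_agree_le _ u
      _ ≤ 2 ^ (2 * k) := Nat.pow_le_pow_right (by norm_num) card_compl_freeOf_le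
      _ = 4 ^ k := by rw [pow_mul]; norm_num
  have himg : G.image f ⊆ univ.filter fun u : Fin n → Bool => ringWinU c y u = false := by
    intro u hu
    rw [mem_image] at hu
    obtain ⟨t, ht, rfl⟩ := hu
    refine mem_filter.2 ⟨mem_univ _, ?_⟩
    rw [hf]
    simp only [ht, dif_pos]
    exact hzl ⟨t, ht⟩
  have hGle : G.card ≤ 4 ^ k * (univ.filter fun u : Fin n → Bool => ringWinU c y u = false).card :=
    (Finset.card_le_mul_card_image G (4 ^ k) hfib).trans (Nat.mul_le_mul_left _ (card_le_card himg))
  -- (4) conclude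
  have htot : (univ.filter fun u : Fin n → Bool => ringWinU c y u = true).card +
      (univ.filter fun u : Fin n → Bool => ringWinU c y u = false).card = 2 ^ n := by
    have h := Finset.card_filter_add_card_filter_not
      (s := (univ : Finset (Fin n → Bool))) (fun u => ringWinU c y u = true)
    rw [Finset.card_univ, Fintype.card_fun, Fintype.card_bool, Fintype.card_fin] at h
    rw [← h]
    congr 2
    ext u
    simp
  have hGle' : (G.card : ℝ) ≤ (4 : ℝ) ^ k * ((univ.filter fun u : Fin n → Bool => ringWinU c y u = false).card : ℝ) := by
    exact_mod_cast hGle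
  have htot' : ((univ.filter fun u : Fin n → Bool => ringWinU c y u = true).card : ℝ) +
      ((univ.filter fun u : Fin n → Bool => ringWinU c y u = false).card : ℝ) = (2 : ℝ) ^ n := by
    exact_mod_cast htot
  have h4pos : (0 : ℝ) < (4 : ℝ) ^ k := by positivity
  have hL : (2 : ℝ) ^ n / 4 / (4 : ℝ) ^ k ≤ ((univ.filter fun u : Fin n → Bool => ringWinU c y u = false).card : ℝ) := by
    rw [div_le_iff₀ h4pos]
    linarith
  have he : (1 - (1 / 4 : ℝ) ^ (k + 1)) * (2 : ℝ) ^ n = (2 : ℝ) ^ n - (2 : ℝ) ^ n / 4 / (4 : ℝ) ^ k := by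
    rw [pow_succ, one_div_pow]
    field_simp
    try ring
  rw [he]
  linarith

end HybridLaw

end Summit.QuantumAdvantage.QuantumAdvantage.Theorems.PartyDial
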